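import Summits.ABC.ABC.Theses.FeketeScales
import Summits.ABC.ABC.Theorems.ScaleSubmultiplicativity.Negative.TwoPrimeShapes

/-!
# Small radical scales are super-multiplicative (negative-side lemma for crux stmt-ABC-2160)

Helper file on the NEGATIVE lane of the crux `Summit.ABC.ABC.Theses.FeketeScales.ScaleSubmultiplicativity`
(route `FeketeScales`, ABC/ABC; disprover refuter-cdisprove-stmt-ABC-2160-0).  With
`G(R) := max {c : (a,b,c) abc triple, rad(abc) ≤ R}` the crux asserts
`G(R₁R₂) ≤ K e^{(log R₁R₂)^θ} G(R₁) G(R₂)` for `R₁, R₂ ≥ R₀`.  This file certifies the small-scale data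
quoted in the crux's docstring ("`G(14) = G(15) = 9 < G(210)` forces `R₀`") in a sharper form:

* `ScaleSubmultiplicativity.c_le_nine_of_rad_le` : every abc triple with `rad(abc) ≤ 29` has `c ≤ 9`
  — i.e. `G(R) = 9` for `6 ≤ R ≤ 29` (the radical of a triple is even; an even squarefree number `≤ 29`
  is `2` or `2p` with `p ∈ {3,5,7,11,13}`, two odd primes giving `rad ≥ 30`; then the shape lemma and the
  congruences of `Negative/TwoPrimeShapes.lean`);
* `ScaleSubmultiplicativity.isABCTriple_289_6272_6561`, `…rad_289_6272_6561` : `17² + 2⁷·7² = 3⁸` is an abc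
  triple of radical `714 ≤ 27·27`;
* `ScaleSubmultiplicativity.supermultiplicative_at_27` : at the split `R₁ = R₂ = 27` the record at scale
  `R₁R₂` is at least `81 · c₁ c₂` for ALL shadow pairs (`G(729) ≥ 6561 = 81 · G(27)²`), so the G-free
  inequality of the crux FAILS at `(27, 27)` whenever `K e^{(log 729)^θ} < 81`;
  `ScaleSubmultiplicativity.constant_ge_81_of_threshold_le_27` : any witness `(θ, K, R₀)` of the crux's
  inequality with `R₀ ≤ 27` pays `K · exp((log 729)^θ) ≥ 81` — the threshold `R₀` is load-bearing;
* `ScaleSubmultiplicativity.exists_triple_at_scale_not_three` : TIGHTNESS of the shadow lemma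
  `SubmultOfRST.exists_triple_at_scale` (`rad ≤ R < 4c` for `R ≥ 4`): the `4` cannot be `3` (`R = 29`);
* `ScaleSubmultiplicativity.record_jump_at_30` : `G(30) ≥ 128 > 14 · G(29)` (records appear suddenly: a
  threshold-free "left-continuity" form of the crux with slack `e^{√log R}` is false at `R = 30`).

Context (disproof workfile `Cruxes/ScaleSubmultiplicativity/Disproof.lean` §3–§4): the crux itself is
implied by Robert–Stewart–Tenenbaum's Conjecture A and cannot be refuted by finite tables (`R₀` is
existential); what finite tables DO show is that every "all scales / moderate constant" variant is false, the
census maxima `K(R₀, θ)` (BarrierNotesIdeator3 §C) being driven by exactly this frozen range `G ≡ 9` on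
`[6, 29]`.  Elementary; Mathlib only.
-/

-- `Summit.<Summit>.<Problem>` is the mandated summit-side namespace (CONVENTIONS §2); for the
-- single-conjunct summit `ABC` the two coincide, so the duplicate `ABC.ABC` is deliberate.
set_option linter.dupNamespace false

namespace Summit.ABC.ABC.Theorems

open Literature.NumberTheory.DiophantineGeometry

/-! ### `G(R) = 9` for `6 ≤ R ≤ 29` -/

/-- The radical of an abc triple is even (`a + b = c` forces `2 ∣ abc`). [folklore] -/
theorem ScaleSubmultiplicativity.two_dvd_mul (a b c : ℕ) (habc : a + b = c) : 2 ∣ a * b * c := by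
  rcases Nat.even_or_odd a with ha | ha
  · exact (ha.two_dvd.mul_right b).mul_right c
  rcases Nat.even_or_odd b with hb | hb
  · exact (hb.two_dvd.mul_left a).mul_right c
  · have hc : Even c := habc ▸ ha.add_odd hb
    exact hc.two_dvd.mul_left (a * b)

/-- **Every abc triple of radical at most `29` has `c ≤ 9`**, i.e. `G(R) = 9` for `6 ≤ R ≤ 29`
(attained by `1 + 8 = 9`).  The radical is even and squarefree, so it is `2` or `2p` with
`p ∈ {3, 5, 7, 11, 13}` (two odd primes would give `rad ≥ 30`); the shape lemma and the congruence
lemmas above conclude (for `{2, 3}` this is Levi ben Gerson's theorem, 1343). [folklore] -/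
theorem ScaleSubmultiplicativity.c_le_nine_of_rad_le {a b c : ℕ} (h : IsABCTriple a b c)
    (hrad : rad a b c ≤ 29) : c ≤ 9 := by
  have h' := h
  obtain ⟨ha, hb, habc, hcop⟩ := h'
  have hc : 0 < c := by omega
  set n : ℕ := a * b * c with hn_def
  have hn0 : n ≠ 0 := by positivity
  rw [rad_def] at hrad
  -- primes of `n` divide `radical n`
  have hdvd_rad : ∀ q, q.Prime → q ∣ n → q ∣ UniqueFactorizationMonoid.radical n := by
    intro q hq hqn
    apply Nat.dvd_of_mem_primeFactors
    rw [Nat.primeFactors_radical]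
    exact Nat.mem_primeFactors.mpr ⟨hq, hqn, hn0⟩
  have h2n : 2 ∣ n := ScaleSubmultiplicativity.two_dvd_mul a b c habc
  have h2r : 2 ∣ UniqueFactorizationMonoid.radical n := hdvd_rad 2 Nat.prime_two h2n
  -- every odd prime factor `q` of `n` has `2q ∣ rad ≤ 29`
  have hodd : ∀ q, q.Prime → q ∣ n → q ≠ 2 → 2 * q ≤ 29 := by
    intro q hq hqn hq2
    have hcop2 : Nat.Coprime 2 q := (Nat.coprime_primes Nat.prime_two hq).mpr (Ne.symm hq2)
    have h2q : 2 * q ∣ UniqueFactorizationMonoid.radical n :=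
      hcop2.mul_dvd_of_dvd_of_dvd h2r (hdvd_rad q hq hqn)
    exact (Nat.le_of_dvd (Nat.radical_pos n) h2q).trans hrad
  -- and two distinct odd prime factors are impossible (`2·3·5 = 30 > 29`)
  have huniq : ∀ q q', q.Prime → q ∣ n → q ≠ 2 → q'.Prime → q' ∣ n → q' ≠ 2 → q = q' := by
    intro q q' hq hqn hq2 hq' hq'n hq'2
    by_contra hne
    have hcop2 : Nat.Coprime 2 q := (Nat.coprime_primes Nat.prime_two hq).mpr (Ne.symm hq2)
    have hcopqq : Nat.Coprime q q' := (Nat.coprime_primes hq hq').mpr hne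
    have hcop3 : Nat.Coprime (2 * q) q' := Nat.Coprime.mul_left
      ((Nat.coprime_primes Nat.prime_two hq').mpr (Ne.symm hq'2)) hcopqq
    have hdvd : 2 * q * q' ∣ UniqueFactorizationMonoid.radical n :=
      hcop3.mul_dvd_of_dvd_of_dvd (hcop2.mul_dvd_of_dvd_of_dvd h2r (hdvd_rad q hq hqn))
        (hdvd_rad q' hq' hq'n)
    have hle : 2 * q * q' ≤ 29 := (Nat.le_of_dvd (Nat.radical_pos n) hdvd).trans hrad
    have hq3 : 3 ≤ q := by
      have := hq.two_le
      omega
    have hq'3 : 3 ≤ q' := by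
      have := hq'.two_le
      omega
    -- one of them is `≠ 3`, hence `≥ 5`
    rcases eq_or_ne q 3 with rfl | hq3'
    · have h5 : 5 ≤ q' := hq'.five_le_of_ne_two_of_ne_three hq'2 (Ne.symm hne)
      omega
    · have h5 : 5 ≤ q := hq.five_le_of_ne_two_of_ne_three hq2 hq3'
      have := Nat.mul_le_mul h5 hq'3
      have h2 : 2 * q * q' = 2 * (q * q') := by ring
      omega
  -- choose the odd prime `p` (or `p = 3` if `n` is a power of `2`)
  by_cases hex : ∃ q, q.Prime ∧ q ∣ n ∧ q ≠ 2
  · obtain ⟨p, hpp, hpn, hp2⟩ := hex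
    have hprimes : ∀ q, q.Prime → q ∣ a * b * c → q = 2 ∨ q = p := by
      intro q hq hqn
      by_cases hq2 : q = 2
      · exact Or.inl hq2
      · exact Or.inr (huniq q p hq hqn hq2 hpp hpn hp2)
    have hp29 : 2 * p ≤ 29 := hodd p hpp hpn hp2
    have hp3 : 3 ≤ p := by
      have := hpp.two_le
      omega
    have hp14 : p ≤ 14 := by omega
    have hp : p = 3 ∨ p = 5 ∨ p = 7 ∨ p = 11 ∨ p = 13 := by
      interval_cases p <;> first | decide | exact absurd hpp (by norm_num)
    exact ScaleSubmultiplicativity.le_nine_of_shape hp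
      (ScaleSubmultiplicativity.shape_of_primeFactors_subset h hpp hp2 hprimes)
  · push Not at hex
    have hprimes : ∀ q, q.Prime → q ∣ a * b * c → q = 2 ∨ q = 3 := by
      intro q hq hqn
      exact Or.inl (hex q hq hqn)
    exact ScaleSubmultiplicativity.le_nine_of_shape (Or.inl rfl)
      (ScaleSubmultiplicativity.shape_of_primeFactors_subset h Nat.prime_three (by norm_num) hprimes)

/-- The bound `c ≤ 9` below radical `30` is attained: `1 + 8 = 9` has radical `6`; so `G(R) = 9` exactly for
`6 ≤ R ≤ 29`. [folklore] -/
theorem ScaleSubmultiplicativity.nine_attained : IsABCTriple 1 8 9 ∧ rad 1 8 9 = 6 := by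
  refine ⟨⟨by norm_num, by norm_num, by norm_num, by norm_num [Nat.coprime_iff_gcd_eq_one]⟩, ?_⟩
  rw [rad_def, show (1 * 8 * 9 : ℕ) = 2 ^ 3 * 3 ^ 2 by norm_num]
  have h1 : IsRelPrime (2 ^ 3 : ℕ) (3 ^ 2) := by
    rw [← Nat.coprime_iff_isRelPrime]; norm_num
  rw [UniqueFactorizationMonoid.radical_mul h1, UniqueFactorizationMonoid.radical_pow _ (by norm_num),
    UniqueFactorizationMonoid.radical_pow _ (by norm_num)]
  rw [UniqueFactorizationMonoid.radical_of_prime (Nat.prime_iff.mp Nat.prime_two),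
    UniqueFactorizationMonoid.radical_of_prime (Nat.prime_iff.mp Nat.prime_three)]
  simp

/-! ### A record at scale `714 ≤ 27·27` -/

/-- `17² + 2⁷·7² = 3⁸`, i.e. `289 + 6272 = 6561`, is an abc triple. [folklore] -/
theorem ScaleSubmultiplicativity.isABCTriple_289_6272_6561 : IsABCTriple 289 6272 6561 := by
  refine ⟨by norm_num, by norm_num, by norm_num, ?_⟩
  norm_num [Nat.coprime_iff_gcd_eq_one]

/-- In `ℕ` the radical of a prime is the prime itself. [folklore] -/
theorem ScaleSubmultiplicativity.radical_natPrime {p : ℕ} (hp : p.Prime) :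
    UniqueFactorizationMonoid.radical p = p := by
  rw [UniqueFactorizationMonoid.radical_of_prime (Nat.prime_iff.mp hp)]; simp

/-- `rad(289 · 6272 · 6561) = rad(17² · 2⁷ 7² · 3⁸) = 17 · 14 · 3 = 714`. [folklore] -/
theorem ScaleSubmultiplicativity.rad_289_6272_6561 : rad 289 6272 6561 = 714 := by
  rw [rad_def, show (289 * 6272 * 6561 : ℕ) = 17 ^ 2 * ((2 ^ 7 * 7 ^ 2) * 3 ^ 8) by norm_num]
  have h1 : IsRelPrime (17 ^ 2 : ℕ) ((2 ^ 7 * 7 ^ 2) * 3 ^ 8) := by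
    rw [← Nat.coprime_iff_isRelPrime]; norm_num
  have h2 : IsRelPrime (2 ^ 7 * 7 ^ 2 : ℕ) (3 ^ 8) := by
    rw [← Nat.coprime_iff_isRelPrime]; norm_num
  have h3 : IsRelPrime (2 ^ 7 : ℕ) (7 ^ 2) := by
    rw [← Nat.coprime_iff_isRelPrime]; norm_num
  rw [UniqueFactorizationMonoid.radical_mul h1, UniqueFactorizationMonoid.radical_mul h2,
    UniqueFactorizationMonoid.radical_mul h3,
    UniqueFactorizationMonoid.radical_pow _ (by norm_num), UniqueFactorizationMonoid.radical_pow _ (by norm_num),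
    UniqueFactorizationMonoid.radical_pow _ (by norm_num), UniqueFactorizationMonoid.radical_pow _ (by norm_num),
    ScaleSubmultiplicativity.radical_natPrime (by norm_num),
    ScaleSubmultiplicativity.radical_natPrime (by norm_num),
    ScaleSubmultiplicativity.radical_natPrime (by norm_num),
    ScaleSubmultiplicativity.radical_natPrime (by norm_num)]
  norm_num

/-! ### Consequences for the crux -/

/-- **Super-multiplicativity at `(27, 27)`.**  There is an abc triple of radical `≤ 27 · 27` — namely
`(289, 6272, 6561)`, radical `714` — whose height is at least `81 · c₁ c₂` for EVERY pair of abc triples of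
radical `≤ 27`: the record heights satisfy `G(729) ≥ 6561 = 81 · G(27)²`.  So the G-free inequality of
`ScaleSubmultiplicativity` fails at the split `R₁ = R₂ = 27` whenever `K · e^{(log 729)^θ} < 81`. [folklore] -/
theorem ScaleSubmultiplicativity.supermultiplicative_at_27 :
    ∃ a b c : ℕ, IsABCTriple a b c ∧ rad a b c ≤ 27 * 27 ∧
      ∀ a₁ b₁ c₁ a₂ b₂ c₂ : ℕ, IsABCTriple a₁ b₁ c₁ → rad a₁ b₁ c₁ ≤ 27 → IsABCTriple a₂ b₂ c₂ →
        rad a₂ b₂ c₂ ≤ 27 → 81 * (c₁ * c₂) ≤ c := by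
  refine ⟨289, 6272, 6561, ScaleSubmultiplicativity.isABCTriple_289_6272_6561,
    by rw [ScaleSubmultiplicativity.rad_289_6272_6561]; norm_num, ?_⟩
  intro a₁ b₁ c₁ a₂ b₂ c₂ h₁ hr₁ h₂ hr₂
  have hc₁ := ScaleSubmultiplicativity.c_le_nine_of_rad_le h₁ (hr₁.trans (by norm_num))
  have hc₂ := ScaleSubmultiplicativity.c_le_nine_of_rad_le h₂ (hr₂.trans (by norm_num))
  calc 81 * (c₁ * c₂) ≤ 81 * (9 * 9) := Nat.mul_le_mul_left 81 (Nat.mul_le_mul hc₁ hc₂)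
    _ = 6561 := by norm_num

/-- **The threshold `R₀` of the crux is load-bearing, quantitatively.**  Any witness `(θ, K, R₀)` of the
G-free sub-multiplicativity inequality valid for all `R₁, R₂ ≥ R₀` with `R₀ ≤ 27` must pay
`K · exp((log 729)^θ) ≥ 81` (test the record `(289, 6272, 6561)` at the split `(27, 27)` against the frozen
shadows `cᵢ ≤ 9`).  With `θ ≤ 0` this is `K ≥ 81/e`; the census value `K(R₀ ≤ 10, θ = 0) = 163.5` of the
crux notes is the same phenomenon one record higher (Reyssat against `G(22) = 9`). [folklore] -/
theorem ScaleSubmultiplicativity.constant_ge_81_of_threshold_le_27 {θ K : ℝ} {R₀ : ℕ} (hR₀ : R₀ ≤ 27)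
    (h : ∀ R₁ R₂ : ℕ, R₀ ≤ R₁ → R₀ ≤ R₂ → ∀ a b c : ℕ, IsABCTriple a b c → rad a b c ≤ R₁ * R₂ →
      ∃ a₁ b₁ c₁ a₂ b₂ c₂ : ℕ, IsABCTriple a₁ b₁ c₁ ∧ rad a₁ b₁ c₁ ≤ R₁ ∧ IsABCTriple a₂ b₂ c₂ ∧
        rad a₂ b₂ c₂ ≤ R₂ ∧ (c : ℝ) ≤ K * Real.exp (Real.log ((R₁ : ℝ) * R₂) ^ θ) * c₁ * c₂) :
    81 ≤ K * Real.exp (Real.log 729 ^ θ) := by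
  obtain ⟨a, b, c, habc, hrad, hall⟩ := ScaleSubmultiplicativity.supermultiplicative_at_27
  obtain ⟨a₁, b₁, c₁, a₂, b₂, c₂, h₁, hr₁, h₂, hr₂, hle⟩ := h 27 27 hR₀ hR₀ a b c habc hrad
  have h81 : 81 * (c₁ * c₂) ≤ c := hall a₁ b₁ c₁ a₂ b₂ c₂ h₁ hr₁ h₂ hr₂
  have hc₁ : (1 : ℝ) ≤ c₁ := by
    obtain ⟨ha₁, hb₁, hab₁, -⟩ := h₁; exact_mod_cast (show 1 ≤ c₁ by omega)
  have hc₂ : (1 : ℝ) ≤ c₂ := by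
    obtain ⟨ha₂, hb₂, hab₂, -⟩ := h₂; exact_mod_cast (show 1 ≤ c₂ by omega)
  have h81r : (81 : ℝ) * (c₁ * c₂) ≤ c := by exact_mod_cast h81
  have h729 : ((27 : ℕ) : ℝ) * ((27 : ℕ) : ℝ) = 729 := by norm_num
  rw [h729] at hle
  have hpos : 0 < (c₁ : ℝ) * c₂ := by positivity
  -- `81 c₁c₂ ≤ c ≤ (K e^{…}) c₁ c₂`
  have : (81 : ℝ) * (c₁ * c₂) ≤ K * Real.exp (Real.log 729 ^ θ) * (c₁ * c₂) := by
    calc (81 : ℝ) * (c₁ * c₂) ≤ c := h81r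
      _ ≤ K * Real.exp (Real.log 729 ^ θ) * c₁ * c₂ := hle
      _ = K * Real.exp (Real.log 729 ^ θ) * (c₁ * c₂) := by ring
  exact le_of_mul_le_mul_right this hpos

/-- **Tightness of the shadow lemma.**  `SubmultOfRST.exists_triple_at_scale` gives, at every scale `R ≥ 4`,
an abc triple with `rad ≤ R < 4c`; the constant `4` cannot be improved to `3`: at `R = 29` every abc triple of
radical `≤ 29` has `3c ≤ 27 < 29`. [folklore] -/
theorem ScaleSubmultiplicativity.exists_triple_at_scale_not_three :
    ¬ ∀ R : ℕ, 4 ≤ R → ∃ a b c : ℕ, IsABCTriple a b c ∧ rad a b c ≤ R ∧ R < 3 * c := by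
  intro h
  obtain ⟨a, b, c, habc, hrad, hlt⟩ := h 29 (by norm_num)
  have := ScaleSubmultiplicativity.c_le_nine_of_rad_le habc hrad
  omega

/-- **Record jump at `R = 30`.**  `G(30) ≥ 128` (`3 + 125 = 128`, radical `30`) against `G(29) = 9`: the record
height jumps by a factor `≥ 14` between consecutive scales, more than the `θ = 1/2`, `K = 1` slack
`e^{√(log 30)} < e² < 14` would allow for a "left-continuity" form of the crux without threshold. [folklore] -/
theorem ScaleSubmultiplicativity.record_jump_at_30 :
    (IsABCTriple 3 125 128 ∧ rad 3 125 128 = 30) ∧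
      ∀ a b c : ℕ, IsABCTriple a b c → rad a b c ≤ 29 → 14 * c ≤ 128 := by
  refine ⟨⟨⟨by norm_num, by norm_num, by norm_num, by norm_num [Nat.coprime_iff_gcd_eq_one]⟩, ?_⟩, ?_⟩
  · rw [rad_def, show (3 * 125 * 128 : ℕ) = 3 * (5 ^ 3 * 2 ^ 7) by norm_num]
    have h1 : IsRelPrime (3 : ℕ) (5 ^ 3 * 2 ^ 7) := by
      rw [← Nat.coprime_iff_isRelPrime]; norm_num
    have h2 : IsRelPrime (5 ^ 3 : ℕ) (2 ^ 7) := by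
      rw [← Nat.coprime_iff_isRelPrime]; norm_num
    rw [UniqueFactorizationMonoid.radical_mul h1, UniqueFactorizationMonoid.radical_mul h2,
      UniqueFactorizationMonoid.radical_pow _ (by norm_num), UniqueFactorizationMonoid.radical_pow _ (by norm_num),
      ScaleSubmultiplicativity.radical_natPrime (by norm_num),
      ScaleSubmultiplicativity.radical_natPrime (by norm_num),
      ScaleSubmultiplicativity.radical_natPrime (by norm_num)]
    norm_num
  · intro a b c habc hrad
    have := ScaleSubmultiplicativity.c_le_nine_of_rad_le habc hrad
    omega

end Summit.ABC.ABC.Theorems
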